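import Summits.FinalStateConjecture.FinalStateConjecture.Theses.LaminatedThreshold
import Summits.FinalStateConjecture.FinalStateConjecture.Cruxes.TameExitsLocalise.Lines.birth
import Literature.Geometry.Lorentzian.AFEndRestrict

/-!
# Crux-ideate sketch (round 1, ideator k = 2) for `LaminatedThreshold.TameExitsLocalise`
(stmt-FinalStateConjecture-16894) — idea `core-tail-rectangle`

planner-cruxidea-stmt-FinalStateConjecture-16894-2-0 · 2026-08-17. `sorry`-free: open statements are
`def … : Prop`, and the two theorems are the kernel-checked composition of the line.

* `Good`, `LocalExitWindow` — verbatim the crux's property / conclusion (same text as the strategist's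
  vocabulary; `tameExitsLocalise_iff'` certifies the fold is definitional).
* `RectangleBit d⋆ F` — FIRST LEMMA of the line: the core ⊗ tail rectangle at an exit `F` through `d⋆`
  (a two-parameter admissible family `H a b`, core from `F a`, far field from `F b` off ONE compact set,
  `H c c = F c`, whose `a`-axis is a smooth immersed injective local family) on which goodness FACTORS as
  `P a ∧ Q b` on a punctured window, together with the single bit `Q 0` ("the base datum's own tail is
  late-clean").
* `localExitWindow_of_rectangleBit` (proved): rectangle + bit + good diagonal ⇒ the crux's conclusion.
* `tameExitsLocalise_of_rectangleBit` (proved): if every tame good exit through an exceptional admissible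
  datum carries a rectangle-with-bit, the crux holds BY NAME.
-/

noncomputable section

set_option linter.dupNamespace false

namespace Summit.FinalStateConjecture.FinalStateConjecture.Cruxes.TameExitsLocalise.IdeatorK2

open scoped Manifold ContDiff Topology
open Literature.Geometry.Lorentzian
open Summit.FinalStateConjecture.FinalStateConjecture.Theses.LaminatedThreshold

/-- The parameter line `ℝ¹`. -/
abbrev P1 : Type := EuclideanSpace ℝ (Fin 1)

section Vocabulary

variable {X : Type} [TopologicalSpace X] [ChartedSpace E3 X] [IsManifold (𝓡 3) ∞ X] [T2Space X]
  [SecondCountableTopology X] [ConnectedSpace X]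

/-- **GOOD datum** — verbatim the property whose tame genericity `FinalStateConjecture` asserts. -/
def Good (D : InitialDataSet (𝓡 3) X) : Prop :=
  (∃ 𝒟 : VacuumCauchyDevelopment D, 𝒟.IsMaximal) ∧
    ∀ 𝒟 : VacuumCauchyDevelopment D, 𝒟.IsMaximal →
      Summit.FinalStateConjecture.HasCompleteNullInfinity 𝒟.toCauchyDevelopment ∧
        ∃ (O : Set 𝒟.carrier) (d : FinalStateDecomposition 𝒟.toSpacetime O 2),
          (∀ i, Kerr.IsSubextremal (d.mass i) (d.spin i)) ∧
            O = Summit.FinalStateConjecture.exteriorOf 𝒟.toCauchyDevelopment d.charted ∧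
              Summit.FinalStateConjecture.RaysStayInClosure 𝒟.toCauchyDevelopment O ∧
                Summit.FinalStateConjecture.HasExhaustiveCharts d ∧
                  Summit.FinalStateConjecture.IsFutureOriented d

/-- **Local exit window at `d⋆`** — verbatim the crux's conclusion. -/
def LocalExitWindow (dstar : InitialDataSet (𝓡 3) X) : Prop :=
  ∃ F' : P1 → InitialDataSet (𝓡 3) X,
    InitialDataSet.IsSmoothDataFamily 1 F' ∧ InitialDataSet.IsImmersedAtZero 1 F' ∧ F' 0 = dstar ∧
    Function.Injective F' ∧ (∀ c, F' c ∈ admissibleVacuumData X) ∧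
    (∃ C : Set X, IsCompact C ∧
      ∀ c, ∀ x ∉ C, (F' c).h.inner x = dstar.h.inner x ∧ (F' c).k x = dstar.k x) ∧
    ∃ ε : ℝ, 0 < ε ∧ ∀ c, c ≠ 0 → ‖c‖ < ε → Good (F' c)

/-- **Core ⊗ tail rectangle with its base bit** (the idea's first lemma, as ONE typed object).
At a one-parameter family `F` through `d⋆` there are: a compact set `C`; a two-parameter family `H`
with `H c c = F c` (diagonal = the given exit), every `H a b` admissible and equal to `F b` off `C`
(far field from the `b`-slot, core from the `a`-slot), whose `a`-axis `a ↦ H a 0` is a jointly smooth,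
immersed, injective family; predicates `P` (core) and `Q` (tail) and a window `ε` such that on the
punctured window goodness FACTORS, `Good (H a b) ↔ P a ∧ Q b`; and the base bit `Q 0` holds (the base
datum's own far field is late-clean). The intended `H` is the Chruściel–Delay/Corvino two-parameter
annular gluing of the core of `F a` to the tail of `F b`; the factorisation is weak-field superposition in
the radiation zone + near-zone robustness; `Q 0` is the one `d⋆`-dependent input. -/
def RectangleBit (dstar : InitialDataSet (𝓡 3) X) (F : P1 → InitialDataSet (𝓡 3) X) : Prop :=
  ∃ (C : Set X) (H : P1 → P1 → InitialDataSet (𝓡 3) X) (P Q : P1 → Prop) (ε : ℝ),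
    IsCompact C ∧ 0 < ε ∧
    (∀ c, H c c = F c) ∧
    (∀ a b, H a b ∈ admissibleVacuumData X) ∧
    (∀ a b, ∀ x ∉ C, (H a b).h.inner x = (F b).h.inner x ∧ (H a b).k x = (F b).k x) ∧
    InitialDataSet.IsSmoothDataFamily 1 (fun a ↦ H a 0) ∧
    InitialDataSet.IsImmersedAtZero 1 (fun a ↦ H a 0) ∧
    Function.Injective (fun a ↦ H a 0) ∧
    (∀ a b, a ≠ 0 → ‖a‖ < ε → ‖b‖ < ε → (Good (H a b) ↔ (P a ∧ Q b))) ∧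
    Q 0

/-- **Composition (proved).** Rectangle + base bit + good punctured diagonal ⇒ a local exit window:
the `a`-axis `a ↦ H a 0` is the local family; for `0 < ‖a‖ < ε`, `Good (F a) = Good (H a a)` gives
`P a`, and `P a ∧ Q 0` gives `Good (H a 0)`. -/
theorem localExitWindow_of_rectangleBit {dstar : InitialDataSet (𝓡 3) X}
    {F : P1 → InitialDataSet (𝓡 3) X} (h0 : F 0 = dstar) (hgood : ∀ c, c ≠ 0 → Good (F c))
    (hR : RectangleBit dstar F) : LocalExitWindow dstar := by
  obtain ⟨C, H, P, Q, ε, hC, hε, hdiag, hadm, htail, hsm, himm, hinj, hrect, hQ0⟩ := hR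
  have hz : ‖(0 : P1)‖ < ε := by simpa using hε
  refine ⟨fun a ↦ H a 0, hsm, himm, ?_, hinj, fun c ↦ hadm c 0, ⟨C, hC, fun c x hx ↦ ?_⟩, ε, hε,
    fun c hc hcε ↦ ?_⟩
  · show H 0 0 = dstar
    rw [hdiag, h0]
  · have := htail c 0 x hx
    rwa [h0] at this
  · have hPc : P c := ((hrect c c hc hcε hcε).mp (by rw [hdiag]; exact hgood c hc)).1
    exact (hrect c 0 hc hcε hz).mpr ⟨hPc, hQ0⟩

end Vocabulary

/-- The crux, folded (definitional). -/
theorem tameExitsLocalise_iff' :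
    TameExitsLocalise ↔
      ∀ (X : Type) [TopologicalSpace X] [ChartedSpace E3 X] [IsManifold (𝓡 3) ∞ X] [T2Space X]
        [SecondCountableTopology X] [ConnectedSpace X],
        ∀ dstar ∈ admissibleVacuumData X, ¬ Good dstar →
          (∃ (e : AFEnd X) (F : P1 → InitialDataSet (𝓡 3) X),
            InitialDataSet.IsTameDataFamily e 1 F ∧ InitialDataSet.IsImmersedAtZero 1 F ∧ F 0 = dstar ∧
            Function.Injective F ∧ (∀ c, F c ∈ admissibleVacuumData X) ∧ ∀ c, c ≠ 0 → Good (F c)) →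
          LocalExitWindow dstar :=
  Iff.rfl

/-- **Rectangles at every tame good exit through an exceptional admissible datum** — the line's
single bundled stub (to be cut by crux-plan into: two-parameter annular gluing · rectangle
factorisation for finite-time-type `d⋆` · the base bit `Q 0` · the extremal-threshold flank). -/
def RectangleBitAtExits : Prop :=
  ∀ (X : Type) [TopologicalSpace X] [ChartedSpace E3 X] [IsManifold (𝓡 3) ∞ X] [T2Space X]
    [SecondCountableTopology X] [ConnectedSpace X],
    ∀ dstar ∈ admissibleVacuumData X, ¬ Good dstar →
      ∀ (e : AFEnd X) (F : P1 → InitialDataSet (𝓡 3) X),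
        InitialDataSet.IsTameDataFamily e 1 F → InitialDataSet.IsImmersedAtZero 1 F → F 0 = dstar →
        Function.Injective F → (∀ c, F c ∈ admissibleVacuumData X) → (∀ c, c ≠ 0 → Good (F c)) →
        RectangleBit dstar F

/-- **The crux from rectangles (proved, concludes `TameExitsLocalise` by name).** -/
theorem tameExitsLocalise_of_rectangleBit (h : RectangleBitAtExits) : TameExitsLocalise := by
  intro X _ _ _ _ _ _ dstar hd hbad hexit
  obtain ⟨e, F, hF, himm, h0, hinj, hadm, hgood⟩ := hexit
  exact localExitWindow_of_rectangleBit h0 hgood (h X dstar hd hbad e F hF himm h0 hinj hadm hgood)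


/-! ## Idea 2 `badness-transfers` — contraposition + MGHD locality of naked tips

Dual lever: instead of transferring GOODNESS from the exit member `F c` to the glued local member `L c`
(stability theory), transfer BADNESS from `L c` to `F c` (domain of dependence): a bad glued member is —
classification bit — bad through a NAKED TIP born in the development of a fixed core ball `S`, naked tips
transfer across data agreeing on `S` (locality of the MGHD boundary), and a naked tip in the core of a
GOOD datum contradicts its complete sojourn-`𝓘⁺` (elementary ray count in the settled far region).
`Naked` is abstracted (intended instance: "some MGHD has a TIP whose causal past meets `Σ` inside `S`"). -/

section BadnessTransfer

variable {X : Type} [TopologicalSpace X] [ChartedSpace E3 X] [IsManifold (𝓡 3) ∞ X] [T2Space X]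
  [SecondCountableTopology X] [ConnectedSpace X]

/-- **Naked-tip transfer kit at `(d⋆, F)`** (first lemma of idea 2, ONE typed object). A glued LOCAL family
`L` through `d⋆` (smooth, immersed, injective, admissible, `= d⋆` off the compact `C`, `= F c` on the core
set `S`), an abstract badness certificate `Naked` with: (NT) locality — it transfers between admissible data
agreeing on `S`; (NL) a naked admissible datum is not good; (CB) classification bit — on a punctured window
every BAD member of `L` is `Naked`. -/
def NakedTransferAt (dstar : InitialDataSet (𝓡 3) X) (F : P1 → InitialDataSet (𝓡 3) X) : Prop :=
  ∃ (L : P1 → InitialDataSet (𝓡 3) X) (C S : Set X) (Naked : InitialDataSet (𝓡 3) X → Prop) (ε : ℝ),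
    IsCompact C ∧ 0 < ε ∧
    InitialDataSet.IsSmoothDataFamily 1 L ∧ InitialDataSet.IsImmersedAtZero 1 L ∧ Function.Injective L ∧
    L 0 = dstar ∧ (∀ c, L c ∈ admissibleVacuumData X) ∧
    (∀ c, ∀ x ∉ C, (L c).h.inner x = dstar.h.inner x ∧ (L c).k x = dstar.k x) ∧
    (∀ c, ∀ x ∈ S, (L c).h.inner x = (F c).h.inner x ∧ (L c).k x = (F c).k x) ∧
    (∀ d₁ ∈ admissibleVacuumData X, ∀ d₂ ∈ admissibleVacuumData X,
      (∀ x ∈ S, d₁.h.inner x = d₂.h.inner x ∧ d₁.k x = d₂.k x) → Naked d₁ → Naked d₂) ∧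
    (∀ d ∈ admissibleVacuumData X, Naked d → ¬ Good d) ∧
    (∀ c, c ≠ 0 → ‖c‖ < ε → ¬ Good (L c) → Naked (L c))

omit [T2Space X] [SecondCountableTopology X] in
/-- **Composition (proved).** Kit + admissible good punctured exit ⇒ local exit window: the glued `L` is
the local family; if `L c` were bad it would be `Naked` (CB), so would `F c` (NT, same core on `S`), so
`F c` would be bad (NL) — contradicting the hypothesis. No goodness is ever transported. -/
theorem localExitWindow_of_nakedTransfer {dstar : InitialDataSet (𝓡 3) X}
    {F : P1 → InitialDataSet (𝓡 3) X} (hadmF : ∀ c, F c ∈ admissibleVacuumData X)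
    (hgood : ∀ c, c ≠ 0 → Good (F c)) (h : NakedTransferAt dstar F) : LocalExitWindow dstar := by
  obtain ⟨L, C, S, Naked, ε, hC, hε, hsm, himm, hinj, h0, hadm, hoff, hcore, hNT, hNL, hCB⟩ := h
  refine ⟨L, hsm, himm, h0, hinj, hadm, ⟨C, hC, hoff⟩, ε, hε, fun c hc hcε ↦ ?_⟩
  by_contra hbad
  have h₁ : Naked (L c) := hCB c hc hcε hbad
  have h₂ : Naked (F c) := hNT (L c) (hadm c) (F c) (hadmF c) (hcore c) h₁
  exact hNL (F c) (hadmF c) h₂ (hgood c hc)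

end BadnessTransfer

/-- **Kits at every tame good exit through an exceptional admissible datum** — idea 2's bundled stub
(to be cut into: one-parameter annular gluing with core agreement · tip locality NT · sojourn count NL ·
classification bit CB). -/
def NakedTransferAtExits : Prop :=
  ∀ (X : Type) [TopologicalSpace X] [ChartedSpace E3 X] [IsManifold (𝓡 3) ∞ X] [T2Space X]
    [SecondCountableTopology X] [ConnectedSpace X],
    ∀ dstar ∈ admissibleVacuumData X, ¬ Good dstar →
      ∀ (e : AFEnd X) (F : P1 → InitialDataSet (𝓡 3) X),
        InitialDataSet.IsTameDataFamily e 1 F → InitialDataSet.IsImmersedAtZero 1 F → F 0 = dstar →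
        Function.Injective F → (∀ c, F c ∈ admissibleVacuumData X) → (∀ c, c ≠ 0 → Good (F c)) →
        NakedTransferAt dstar F

/-- **The crux from naked-tip transfer (proved, concludes `TameExitsLocalise` by name).** -/
theorem tameExitsLocalise_of_nakedTransfer (h : NakedTransferAtExits) : TameExitsLocalise := by
  intro X _ _ _ _ _ _ dstar hd hbad hexit
  obtain ⟨e, F, hF, himm, h0, hinj, hadm, hgood⟩ := hexit
  exact localExitWindow_of_nakedTransfer hadm hgood (h X dstar hd hbad e F hF himm h0 hinj hadm hgood)


/-! ## Route-level consequence of idea 2 (for the tenure planner): the re-cut `A⁺ ∧ S1 ⇒ ¬ FSC`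

If crux A certifies NAKED saturation (its layer-2 item `ThresholdLeavesAreNaked`, typed with an abstract local
badness certificate `Nk` carrying NT and NL), then crux B disappears from the route: the deciding theorem needs
only birth's registered elliptic stub S1 `ParametricTailGluing`. `closes_recut` below is that deciding theorem,
fully proved; it is `closes` with B's call replaced by gluing + the three-step badness transfer. -/

/-- **A⁺ — laminated threshold with NAKED saturation (candidate restatement of crux A; signature only).**
As `LaminatedThreshold`, plus: the witness `d⋆` has no Killing tail on any sole end (so S1 applies), and there
are a compact core set `S` and a badness certificate `Nk` which (NL) implies exceptionality, (NT) transfers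
between admissible data agreeing on `S`, and (saturation) holds at every `K`-coded member of every compactly
supported admissible family through `d⋆`. Intended `Nk d`: "some MGHD of `d` has a naked TIP whose past meets
`Σ` inside `S`" (`ThresholdLeavesAreNaked` of the route header). -/
def LaminatedThresholdNaked : Prop :=
  ∃ (X : Type) (_ : TopologicalSpace X) (_ : ChartedSpace E3 X) (_ : IsManifold (𝓡 3) ∞ X) (_ : T2Space X)
    (_ : SecondCountableTopology X) (_ : ConnectedSpace X) (dstar : InitialDataSet (𝓡 3) X)
    (Φ : InitialDataSet (𝓡 3) X → ℝ) (K : Set ℝ) (S : Set X) (Nk : InitialDataSet (𝓡 3) X → Prop),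
    dstar ∈ admissibleVacuumData X ∧ ¬ Good dstar ∧ IsCompact S ∧
    (∀ e : AFEnd X, e.IsSoleEnd → Birth.NoKillingTail e dstar) ∧
    (∀ d ∈ admissibleVacuumData X, Nk d → ¬ Good d) ∧
    (∀ d₁ ∈ admissibleVacuumData X, ∀ d₂ ∈ admissibleVacuumData X,
      (∀ x ∈ S, d₁.h.inner x = d₂.h.inner x ∧ d₁.k x = d₂.k x) → Nk d₁ → Nk d₂) ∧
    Φ dstar ∈ K ∧
    (∀ ε : ℝ, 0 < ε → (K ∩ Set.Ioo (Φ dstar - ε) (Φ dstar)).Nonempty ∧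
      (K ∩ Set.Ioo (Φ dstar) (Φ dstar + ε)).Nonempty) ∧
    ∀ F : P1 → InitialDataSet (𝓡 3) X, InitialDataSet.IsSmoothDataFamily 1 F → F 0 = dstar →
      (∀ c, F c ∈ admissibleVacuumData X) →
      (∃ C : Set X, IsCompact C ∧ ∀ c, ∀ x ∉ C, (F c).h.inner x = dstar.h.inner x ∧ (F c).k x = dstar.k x) →
      ∃ δ : ℝ, 0 < δ ∧ ContinuousOn (fun c ↦ Φ (F c)) (Metric.ball 0 δ) ∧
        ∀ c ∈ Metric.ball (0 : P1) δ, Φ (F c) ∈ K → Nk (F c)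

/-- **Deciding theorem of the re-cut route (PROVED): `A⁺ → S1 → ¬ FinalStateConjecture`.** From FSC take the
tame exit `F` at `d⋆`; glue it to `d⋆`'s tail beyond a radius past `S` (S1, KID-free by A⁺); along the punctured
segment of the glued LOCAL family `L`, a `K`-coded member would be `Nk` (saturation), hence so would the exit
member with the same core (NT), hence that good member would be exceptional (NL) — so the segment's codes avoid
`K`, and the lamination lemma (connectedness, verbatim from `closes`) gives the contradiction. No goodness of any
glued datum, no stability, no tail cleanliness is used. -/
theorem closes_recut (hA : LaminatedThresholdNaked) (hS1 : Birth.ParametricTailGluing) :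
    ¬ FinalStateConjecture := by
  obtain ⟨X, i₁, i₂, i₃, i₄, i₅, i₆, dstar, Φ, K, S, Nk, hD, hbad, hS, hnokid, hNL, hNT, hk, hacc, hsat⟩ := hA
  intro hFSC
  obtain ⟨e, F, hF, himm, h0, hinj, hadm, hexc⟩ := hFSC X dstar ⟨hD, hbad⟩
  have hgoodF : ∀ c, c ≠ 0 → Good (F c) := fun c hc ↦ by
    by_contra hP
    exact hexc c hc ⟨hadm c, hP⟩
  -- glue beyond a radius past the core set `S`
  obtain ⟨R₀, hR₀⟩ := e.exists_forall_far_disjoint hS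
  obtain ⟨R₁, hR₀₁, L, ε₁, hL, -, hL0, -, hadmL, hCL, hε₁, hcore⟩ :=
    hS1 X e dstar F hD hF himm h0 hinj hadm (hnokid e hF.2.1) R₀
  have hagree : ∀ c, ‖c‖ < ε₁ → ∀ x ∈ S,
      (L c).h.inner x = (F c).h.inner x ∧ (L c).k x = (F c).k x := fun c hc x hx ↦
    hcore c hc x (Set.disjoint_right.1 (hR₀ R₁ hR₀₁) hx)
  obtain ⟨δ, hδ, hcont, hK⟩ := hsat L hL hL0 hadmL hCL
  -- the segment direction in the one-dimensional parameter space
  set v : P1 := EuclideanSpace.single (0 : Fin 1) (1 : ℝ) with hv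
  have hnv : ‖v‖ = 1 := by simp [hv]
  have hv0 : v ≠ 0 := by
    intro h; rw [h, norm_zero] at hnv; exact zero_ne_one hnv
  set ρ : ℝ := min δ ε₁ / 2 with hρ
  have hρpos : 0 < ρ := by positivity
  have hρδ : ρ < δ := by
    have : min δ ε₁ ≤ δ := min_le_left _ _
    rw [hρ]; linarith
  have hρε : ρ < ε₁ := by
    have : min δ ε₁ ≤ ε₁ := min_le_right _ _
    rw [hρ]; linarith
  set f : ℝ → ℝ := fun t ↦ Φ (L (t • v)) with hf
  have hnorm : ∀ t : ℝ, ‖t • v‖ = |t| := fun t ↦ by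
    rw [norm_smul, hnv, mul_one, Real.norm_eq_abs]
  -- values along the punctured segment avoid K: BADNESS TRANSFER (saturation → NT → NL vs goodness of F)
  have hnotK : ∀ t ∈ Set.Ioo (0 : ℝ) ρ, f t ∉ K := by
    intro t ht hmem
    have htne : t • v ≠ 0 := smul_ne_zero (ne_of_gt ht.1) hv0
    have hball : t • v ∈ Metric.ball (0 : P1) δ := by
      rw [mem_ball_zero_iff, hnorm, abs_of_pos ht.1]; exact ht.2.trans hρδ
    have hlt : ‖t • v‖ < ε₁ := by rw [hnorm, abs_of_pos ht.1]; exact ht.2.trans hρε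
    have h₁ : Nk (L (t • v)) := hK (t • v) hball hmem
    have h₂ : Nk (F (t • v)) :=
      hNT (L (t • v)) (hadmL _) (F (t • v)) (hadm _) (hagree (t • v) hlt) h₁
    exact hNL (F (t • v)) (hadm _) h₂ (hgoodF (t • v) htne)
  -- continuity of f on the segment and at 0
  have hγ : Continuous fun t : ℝ ↦ t • v := continuous_id.smul continuous_const
  have hmaps : Set.MapsTo (fun t : ℝ ↦ t • v) (Set.Ioo 0 ρ) (Metric.ball 0 δ) := by
    intro t ht
    rw [mem_ball_zero_iff, hnorm, abs_of_pos ht.1]; exact ht.2.trans hρδ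
  have hfcont : ContinuousOn f (Set.Ioo 0 ρ) := hcont.comp hγ.continuousOn hmaps
  have hf0 : f 0 = Φ dstar := by simp [hf, hL0]
  have hfat : ContinuousAt f 0 := by
    have h1 : ContinuousAt (fun c ↦ Φ (L c)) 0 :=
      (hcont 0 (Metric.mem_ball_self hδ)).continuousAt (Metric.ball_mem_nhds 0 hδ)
    have h2 : ContinuousAt (fun t : ℝ ↦ t • v) 0 := hγ.continuousAt
    have h3 := ContinuousAt.comp_of_eq (g := fun c ↦ Φ (L c)) (f := fun t : ℝ ↦ t • v) h1 h2
      (by simp)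
    simpa [hf, Function.comp_def] using h3
  have htend : Filter.Tendsto f (𝓝[>] 0) (𝓝 (Φ dstar)) := by
    rw [← hf0]; exact tendsto_nhdsWithin_of_tendsto_nhds hfat
  have hpre : IsPreconnected (f '' Set.Ioo 0 ρ) := isPreconnected_Ioo.image f hfcont
  have hconst : ∀ t₀ ∈ Set.Ioo (0 : ℝ) ρ, f t₀ = Φ dstar := by
    intro t₀ ht₀
    rcases lt_trichotomy (f t₀) (Φ dstar) with hlt | heq | hgt
    · obtain ⟨k₁, hk₁K, hk₁⟩ := (hacc (Φ dstar - f t₀) (by linarith)).1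
      have hk₁lo : f t₀ < k₁ := by have := hk₁.1; linarith
      have hk₁hi : k₁ < Φ dstar := hk₁.2
      have hev : ∀ᶠ t in 𝓝[>] (0 : ℝ), k₁ < f t ∧ t ∈ Set.Ioo 0 ρ :=
        ((tendsto_order.1 htend).1 k₁ hk₁hi).and (Ioo_mem_nhdsGT hρpos)
      obtain ⟨t, hkt, ht⟩ := hev.exists
      have hsub : Set.Icc (f t₀) (f t) ⊆ f '' Set.Ioo 0 ρ :=
        hpre.Icc_subset (Set.mem_image_of_mem f ht₀) (Set.mem_image_of_mem f ht)
      obtain ⟨t₁, ht₁, hft₁⟩ := hsub ⟨hk₁lo.le, hkt.le⟩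
      exact absurd (hft₁ ▸ hk₁K) (hnotK t₁ ht₁)
    · exact heq
    · obtain ⟨k₁, hk₁K, hk₁⟩ := (hacc (f t₀ - Φ dstar) (by linarith)).2
      have hk₁lo : Φ dstar < k₁ := hk₁.1
      have hk₁hi : k₁ < f t₀ := by have := hk₁.2; linarith
      have hev : ∀ᶠ t in 𝓝[>] (0 : ℝ), f t < k₁ ∧ t ∈ Set.Ioo 0 ρ :=
        ((tendsto_order.1 htend).2 k₁ hk₁lo).and (Ioo_mem_nhdsGT hρpos)
      obtain ⟨t, hkt, ht⟩ := hev.exists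
      have hsub : Set.Icc (f t) (f t₀) ⊆ f '' Set.Ioo 0 ρ :=
        hpre.Icc_subset (Set.mem_image_of_mem f ht) (Set.mem_image_of_mem f ht₀)
      obtain ⟨t₁, ht₁, hft₁⟩ := hsub ⟨hkt.le, hk₁hi.le⟩
      exact absurd (hft₁ ▸ hk₁K) (hnotK t₁ ht₁)
  have hmid : ρ / 2 ∈ Set.Ioo (0 : ℝ) ρ := ⟨by positivity, by linarith⟩
  exact hnotK (ρ / 2) hmid ((hconst (ρ / 2) hmid).symm ▸ hk)

end Summit.FinalStateConjecture.FinalStateConjecture.Cruxes.TameExitsLocalise.IdeatorK2
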